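import Literature.AlgebraicGeometry.Resolution.PlaneNearForms
import Literature.AlgebraicGeometry.Resolution.NearPointsRational
import HarnessLib

/-!
# Near points over a point centre of a regular threefold: `τ(x) ≤ 2`, and at `τ(x) = 2` the near point is rational (CoP1, Lemma 4.3 (1), (3))

Topic: `Literature/AlgebraicGeometry/Resolution`. [CoP1] = Cossart–Piltant, J. Algebra 320 (2008)
1051–1082, Lemma 4.3, p. 8, for the blowing up `q : X′ → X` of a regular threefold along the
closed point `Y = {x}` (`r = 3`, fibre `q⁻¹(x) ≅ ℙ²_{k(x)}`):

> "(1) If `τ(x) = 3`, then `Y = {x}` and no `x′ ∈ q⁻¹(x)` is near `x`. … (3) If `τ(x) = 2`,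
> `Y = {x}` and `x′ ∈ q⁻¹(x)` is near `x`, then `x′` is uniquely determined, rational over `x` …
> Proof. Assertion (1) is clear from Hironaka's theorem 2 or corollary (3.2) [26]."

PROVED here from the `ℙ²`-case of Hironaka's theorem (`PlaneNearForms.lean`, elementary):

* ring level (`R` regular local of embedding dimension `3`, `c` a regular system of parameters,
  `𝔴 ⊇ 𝔪 B_j` a prime of a chart of the blowing up of `(c) = 𝔪` at which every weak transform
  `F(e)`, `F` a form of degree `μ` with `F(c) ∈ J`, lies in `𝔴^μ (B_j)_𝔴`):
  `exists_chartResidueMap_forall_initialForms_near` (the form-level nearness of `cl_μ(J)` at the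
  prime `ρ(𝔴)` of `k[T_i : i ≠ j]`), `hironakaTauAt_le_two_of_near_point` (**`τ ≤ 2`**),
  `exists_map_eq_span_of_near_point` (**at `τ = 2`: `ρ(𝔴) = (T_i − a_i)` with
  `Y_i − a_i Y_j ∈ T_x`**), `quotient_mk_comp_chartBase_surjective_of_near_point`,
  `isMaximal_of_near_point` (`R → B_j/𝔴` onto), `eq_of_near_point_of_near_point` (uniqueness
  within a chart);
* scheme level (`π` the blowing up of a regular locally Noetherian `X` along a regular centre
  `Y ⊆ {ord = μ}` with `𝓘_{Y,x} = 𝔪_x` at `x = π x′`, `dim 𝒪_{X,x} = 3`):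
  `IsBlowup.stalkTau_le_two_of_isNear_point`, `IsBlowup.not_isNear_of_stalkTau_eq_three`
  (**Lemma 4.3 (1)**), `IsBlowup.idealOrder_controlledTransform_lt_of_stalkTau_eq_three`, and
  `IsBlowup.residue_comp_stalkMap_surjective_of_isNear_point` (**Lemma 4.3 (3), rationality:
  `k(x) → k(x′)` is onto at a near point when `τ(x) = 2`**).

## Sources

* V. Cossart, O. Piltant, J. Algebra 320 (2008) 1051–1082, Lemma 4.3 (1), (3), p. 8.
  [CossartPiltant2008]
* H. Hironaka, Ann. of Math. 92 (1970) 327–334, Thm. 2. [Hironaka1970]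
-/

noncomputable section

open CategoryTheory CategoryTheory.Limits AlgebraicGeometry TopologicalSpace IsLocalRing MvPolynomial

namespace Literature.AlgebraicGeometry.Resolution

universe u

open Scheme.IdealSheafData

/-! ## Ring level: a point centre `(c) = 𝔪` of a regular local ring of embedding dimension three -/

section Ring

variable {R : Type u} [CommRing R] [IsRegularLocalRing R]

/-- **Nearness of `cl_μ(J)` on the fibre plane.** For a regular system of parameters
`c = (c_1, c_2, c_3)` of `R`, a chart `B_j` of the blowing up of `𝔪 = (c)`, and a prime `𝔴 ⊇ 𝔪 B_j`
at which all weak transforms `F(e)` (`F` a form of degree `μ`, `F(c) ∈ J`) lie in `𝔴^μ (B_j)_𝔴`: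
with `ρ : B_j → k[T_i : i ≠ j]` the reduction modulo `𝔪 B_j` (`exists_chartResidueMap`) and
`𝔮 = ρ(𝔴)`, every `G ∈ cl_μ(J)` satisfies `s · G(T_j := 1) ∈ 𝔮^μ` for some `s ∉ 𝔮`.
[cite: CossartPiltant2008, proof of Prop. 4.2, (11)] -/
theorem exists_chartResidueMap_forall_initialForms_near (hd : (maximalIdeal R).spanFinrank = 3)
    (c : Fin 3 → R) (hc : Ideal.span (Set.range c) = maximalIdeal R) (j : Fin 3)
    {J : Ideal R} {μ : ℕ} (𝔴 : Ideal (chartRing c j)) [𝔴.IsPrime]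
    (h𝔴 : (maximalIdeal R).map (chartBase c j) ≤ 𝔴)
    (hnear : ∀ F : MvPolynomial (Fin 3) R, F.IsHomogeneous μ → MvPolynomial.eval c F ∈ J →
      (algebraMap (chartRing c j) (Localization.AtPrime 𝔴) :
          chartRing c j →+* Localization.AtPrime 𝔴)
          (MvPolynomial.eval₂Hom (chartBase c j) (fun i => chartGen c j i) F) ∈
        maximalIdeal (Localization.AtPrime 𝔴) ^ μ) :
    ∃ ρ : chartRing c j →+* MvPolynomial {i : Fin 3 // i ≠ j} (ResidueField R),
      Function.Surjective ρ ∧ RingHom.ker ρ = (maximalIdeal R).map (chartBase c j) ∧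
      (∀ F : MvPolynomial (Fin 3) R,
        ρ (MvPolynomial.eval₂Hom (chartBase c j) (fun i => chartGen c j i) F) =
          MvPolynomial.map (residue R) (dehomogenize j F)) ∧
      (𝔴.map ρ).IsPrime ∧ 𝔴 = (𝔴.map ρ).comap ρ ∧
      ∀ G ∈ (initialForms c J μ : Set (MvPolynomial (Fin 3) (ResidueField R))),
        G.IsHomogeneous μ ∧ ∃ s ∉ 𝔴.map ρ, s * dehomogenize j G ∈ 𝔴.map ρ ^ μ := by
  classical
  have hcq : IsQuasiRegular c := isQuasiRegular_rsop_comp hd c hc id Function.injective_id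
  have hcm : ∀ l, c l ∈ maximalIdeal R := fun l => hc ▸ Ideal.subset_span ⟨l, rfl⟩
  obtain ⟨ρ, hρsurj, hρker, hρF⟩ :
      ∃ ρ : chartRing c j →+* MvPolynomial {i : Fin 3 // i ≠ j} (ResidueField R),
        Function.Surjective ρ ∧ RingHom.ker ρ = (maximalIdeal R).map (chartBase c j) ∧
        ∀ F : MvPolynomial (Fin 3) R,
          ρ (MvPolynomial.eval₂Hom (chartBase c j) (fun i => chartGen c j i) F) =
            MvPolynomial.map (residue R) (dehomogenize j F) :=
    exists_chartResidueMap c j hcq hcm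
  have hker : RingHom.ker ρ ≤ 𝔴 := hρker.trans_le h𝔴
  haveI h𝔮 : (𝔴.map ρ).IsPrime := Ideal.map_isPrime_of_surjective hρsurj hker
  have hcomap : 𝔴 = (𝔴.map ρ).comap ρ := by
    rw [Ideal.comap_map_of_surjective ρ hρsurj, ← RingHom.ker_eq_comap_bot, sup_eq_left.mpr hker]
  refine ⟨ρ, hρsurj, hρker, hρF, h𝔮, hcomap, fun G hG => ?_⟩
  obtain ⟨F, hF, hFJ, rfl⟩ := (mem_initialForms_iff c).mp hG
  refine ⟨hF.map _, ?_⟩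
  have hnear' : algebraMap _ (Localization.AtPrime (𝔴.map ρ))
      (MvPolynomial.map (residue R) (dehomogenize j F)) ∈
      maximalIdeal (Localization.AtPrime (𝔴.map ρ)) ^ μ := by
    rw [← hρF F, ← Localization.localRingHom_to_map 𝔴 (𝔴.map ρ) ρ hcomap]
    exact Ideal.map_maximalIdeal_pow_le (Localization.localRingHom 𝔴 (𝔴.map ρ) ρ hcomap) μ
      (Ideal.mem_map_of_mem _ (hnear F hF hFJ))
  obtain ⟨s, hs, hsg⟩ := exists_mul_mem_pow_of_algebraMap_mem_maximalIdeal_pow (𝔴.map ρ)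
    (Localization.AtPrime (𝔴.map ρ)) hnear'
  refine ⟨s, hs, ?_⟩
  rwa [map_dehomogenize] at hsg

/-- **[CoP1] Lemma 4.3 (1), ring level: a near point over a point centre of a regular local ring of
embedding dimension `3` forces `τ ≤ 2`** (Hironaka's Theorem 2 for the fibre plane).
[cite: CossartPiltant2008, Lemma 4.3 (1); Hironaka1970, Thm. 2] -/
theorem hironakaTauAt_le_two_of_near_point (hd : (maximalIdeal R).spanFinrank = 3)
    (c : Fin 3 → R) (hc : Ideal.span (Set.range c) = maximalIdeal R) (j : Fin 3)
    {J : Ideal R} {μ : ℕ} (𝔴 : Ideal (chartRing c j)) [𝔴.IsPrime]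
    (h𝔴 : (maximalIdeal R).map (chartBase c j) ≤ 𝔴)
    (hnear : ∀ F : MvPolynomial (Fin 3) R, F.IsHomogeneous μ → MvPolynomial.eval c F ∈ J →
      (algebraMap (chartRing c j) (Localization.AtPrime 𝔴) :
          chartRing c j →+* Localization.AtPrime 𝔴)
          (MvPolynomial.eval₂Hom (chartBase c j) (fun i => chartGen c j i) F) ∈
        maximalIdeal (Localization.AtPrime 𝔴) ^ μ) :
    hironakaTauAt c J μ ≤ 2 := by
  obtain ⟨ρ, -, -, -, h𝔮, -, hS⟩ :=
    exists_chartResidueMap_forall_initialForms_near hd c hc j 𝔴 h𝔴 hnear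
  haveI := h𝔮
  exact hironakaTau_le_two_of_near j (𝔴.map ρ) hS

/-- **[CoP1] Lemma 4.3 (3), ring level: at `τ = 2` a near point is the rational point of the fibre
plane cut out by the directrix.** With notation as above and `τ = 2`: `ρ(𝔴) = (T_i − a_i : i ≠ j)`
for (unique) `a_i ∈ k` with `Y_i − a_i Y_j ∈ T_x`.
[cite: CossartPiltant2008, Lemma 4.3 (3); Hironaka1970, Thm. 2] -/
theorem exists_map_eq_span_of_near_point (hd : (maximalIdeal R).spanFinrank = 3)
    (c : Fin 3 → R) (hc : Ideal.span (Set.range c) = maximalIdeal R) (j : Fin 3)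
    {J : Ideal R} {μ : ℕ} (𝔴 : Ideal (chartRing c j)) [𝔴.IsPrime]
    (h𝔴 : (maximalIdeal R).map (chartBase c j) ≤ 𝔴)
    (hnear : ∀ F : MvPolynomial (Fin 3) R, F.IsHomogeneous μ → MvPolynomial.eval c F ∈ J →
      (algebraMap (chartRing c j) (Localization.AtPrime 𝔴) :
          chartRing c j →+* Localization.AtPrime 𝔴)
          (MvPolynomial.eval₂Hom (chartBase c j) (fun i => chartGen c j i) F) ∈
        maximalIdeal (Localization.AtPrime 𝔴) ^ μ)
    (hτ : hironakaTauAt c J μ = 2) :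
    ∃ ρ : chartRing c j →+* MvPolynomial {i : Fin 3 // i ≠ j} (ResidueField R),
      Function.Surjective ρ ∧ RingHom.ker ρ = (maximalIdeal R).map (chartBase c j) ∧
      (∀ F : MvPolynomial (Fin 3) R,
        ρ (MvPolynomial.eval₂Hom (chartBase c j) (fun i => chartGen c j i) F) =
          MvPolynomial.map (residue R) (dehomogenize j F)) ∧
      𝔴 = (𝔴.map ρ).comap ρ ∧
      ∃ a : {i : Fin 3 // i ≠ j} → ResidueField R,
        (∀ i, (LinearMap.proj i.1 - a i • LinearMap.proj j :
            Module.Dual (ResidueField R) (Fin 3 → ResidueField R)) ∈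
          directrix (ResidueField R)
            (initialForms c J μ : Set (MvPolynomial (Fin 3) (ResidueField R)))) ∧
        𝔴.map ρ = Ideal.span (Set.range fun i => X i - MvPolynomial.C (a i)) := by
  obtain ⟨ρ, hρsurj, hρker, hρF, h𝔮, hcomap, hS⟩ :=
    exists_chartResidueMap_forall_initialForms_near hd c hc j 𝔴 h𝔴 hnear
  haveI := h𝔮
  obtain ⟨-, a, ha, h𝔮eq⟩ := exists_eq_span_of_near_of_hironakaTau_eq_two j (𝔴.map ρ) hS hτ
  exact ⟨ρ, hρsurj, hρker, hρF, hcomap, a, ha, h𝔮eq⟩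

/-- **[CoP1] Lemma 4.3 (3), rationality on a chart: at `τ = 2`, `R → B_j/𝔴` is onto at a near
prime.** Every `b ∈ B_j` is congruent modulo `𝔴` to the constant `ρ(b)(a)`, which lifts to `R`.
[cite: CossartPiltant2008, Lemma 4.3 (3)] -/
theorem quotient_mk_comp_chartBase_surjective_of_near_point (hd : (maximalIdeal R).spanFinrank = 3)
    (c : Fin 3 → R) (hc : Ideal.span (Set.range c) = maximalIdeal R) (j : Fin 3)
    {J : Ideal R} {μ : ℕ} (𝔴 : Ideal (chartRing c j)) [𝔴.IsPrime]
    (h𝔴 : (maximalIdeal R).map (chartBase c j) ≤ 𝔴)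
    (hnear : ∀ F : MvPolynomial (Fin 3) R, F.IsHomogeneous μ → MvPolynomial.eval c F ∈ J →
      (algebraMap (chartRing c j) (Localization.AtPrime 𝔴) :
          chartRing c j →+* Localization.AtPrime 𝔴)
          (MvPolynomial.eval₂Hom (chartBase c j) (fun i => chartGen c j i) F) ∈
        maximalIdeal (Localization.AtPrime 𝔴) ^ μ)
    (hτ : hironakaTauAt c J μ = 2) :
    Function.Surjective ((Ideal.Quotient.mk 𝔴).comp (chartBase c j)) := by
  classical
  obtain ⟨ρ, -, -, hρF, hcomap, a, -, hq⟩ :=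
    exists_map_eq_span_of_near_point hd c hc j 𝔴 h𝔴 hnear hτ
  have hρC : ∀ r : R, ρ (chartBase c j r) = MvPolynomial.C (residue R r) := fun r => by
    have h := hρF (C r)
    rwa [MvPolynomial.eval₂Hom_C, MvPolynomial.algHom_C, MvPolynomial.algebraMap_eq,
      MvPolynomial.map_C] at h
  intro y
  obtain ⟨b, rfl⟩ := Ideal.Quotient.mk_surjective y
  obtain ⟨r, hr⟩ := Ideal.Quotient.mk_surjective (I := maximalIdeal R) (MvPolynomial.eval a (ρ b))
  refine ⟨r, ?_⟩
  rw [RingHom.comp_apply, Ideal.Quotient.eq, hcomap, Ideal.mem_comap, map_sub, hρC, hq]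
  have h := sub_C_eval_mem_span_range_X_sub_C (ρ b) a
  have hres : (MvPolynomial.C (residue R r) : MvPolynomial {i : Fin 3 // i ≠ j} (ResidueField R)) =
      MvPolynomial.C (MvPolynomial.eval a (ρ b)) := by
    rw [← hr]
    rfl
  rw [hres, ← neg_sub (ρ b) (MvPolynomial.C (MvPolynomial.eval a (ρ b)))]
  exact neg_mem h

/-- Hence **at `τ = 2` a near prime over the closed point is a maximal ideal with residue field
`R/𝔪`** (a closed, `k(x)`-rational point of the fibre plane). [cite: CossartPiltant2008, Lemma 4.3 (3)] -/
theorem isMaximal_of_near_point (hd : (maximalIdeal R).spanFinrank = 3)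
    (c : Fin 3 → R) (hc : Ideal.span (Set.range c) = maximalIdeal R) (j : Fin 3)
    {J : Ideal R} {μ : ℕ} (𝔴 : Ideal (chartRing c j)) [h𝔴p : 𝔴.IsPrime]
    (h𝔴 : (maximalIdeal R).map (chartBase c j) ≤ 𝔴)
    (hnear : ∀ F : MvPolynomial (Fin 3) R, F.IsHomogeneous μ → MvPolynomial.eval c F ∈ J →
      (algebraMap (chartRing c j) (Localization.AtPrime 𝔴) :
          chartRing c j →+* Localization.AtPrime 𝔴)
          (MvPolynomial.eval₂Hom (chartBase c j) (fun i => chartGen c j i) F) ∈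
        maximalIdeal (Localization.AtPrime 𝔴) ^ μ)
    (hτ : hironakaTauAt c J μ = 2) : 𝔴.IsMaximal := by
  have hsurj := quotient_mk_comp_chartBase_surjective_of_near_point hd c hc j 𝔴 h𝔴 hnear hτ
  obtain ⟨f, hf⟩ : ∃ f : R →+* chartRing c j ⧸ 𝔴, f = (Ideal.Quotient.mk 𝔴).comp (chartBase c j) :=
    ⟨_, rfl⟩
  rw [← hf] at hsurj
  haveI : Nontrivial (chartRing c j ⧸ 𝔴) := Ideal.Quotient.nontrivial_iff.mpr h𝔴p.ne_top
  have hker : RingHom.ker f = maximalIdeal R := by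
    refine ((IsLocalRing.maximalIdeal.isMaximal R).eq_of_le (RingHom.ker_ne_top f) ?_).symm
    intro r hr
    rw [RingHom.mem_ker, hf, RingHom.comp_apply, Ideal.Quotient.eq_zero_iff_mem]
    exact h𝔴 (Ideal.mem_map_of_mem _ hr)
  have e : R ⧸ RingHom.ker f ≃+* chartRing c j ⧸ 𝔴 := RingHom.quotientKerEquivOfSurjective hsurj
  have hfield : IsField (chartRing c j ⧸ 𝔴) := by
    have h1 : IsField (R ⧸ RingHom.ker f) := by
      rw [hker]
      exact (Ideal.Quotient.maximal_ideal_iff_isField_quotient _).mp inferInstance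
    exact MulEquiv.isField h1 e.symm.toMulEquiv
  exact Ideal.Quotient.maximal_of_isField _ hfield

/-- **[CoP1] Lemma 4.3 (3), uniqueness within a chart: at `τ = 2`, two near primes `𝔴₁, 𝔴₂ ⊇ 𝔪 B_j`
of the same chart coincide.** [cite: CossartPiltant2008, Lemma 4.3 (3)] -/
theorem eq_of_near_point_of_near_point (hd : (maximalIdeal R).spanFinrank = 3)
    (c : Fin 3 → R) (hc : Ideal.span (Set.range c) = maximalIdeal R) (j : Fin 3)
    {J : Ideal R} {μ : ℕ} (𝔴₁ 𝔴₂ : Ideal (chartRing c j)) [𝔴₁.IsPrime] [𝔴₂.IsPrime]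
    (h𝔴₁ : (maximalIdeal R).map (chartBase c j) ≤ 𝔴₁)
    (h𝔴₂ : (maximalIdeal R).map (chartBase c j) ≤ 𝔴₂)
    (hnear₁ : ∀ F : MvPolynomial (Fin 3) R, F.IsHomogeneous μ → MvPolynomial.eval c F ∈ J →
      (algebraMap (chartRing c j) (Localization.AtPrime 𝔴₁) :
          chartRing c j →+* Localization.AtPrime 𝔴₁)
          (MvPolynomial.eval₂Hom (chartBase c j) (fun i => chartGen c j i) F) ∈
        maximalIdeal (Localization.AtPrime 𝔴₁) ^ μ)
    (hnear₂ : ∀ F : MvPolynomial (Fin 3) R, F.IsHomogeneous μ → MvPolynomial.eval c F ∈ J →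
      (algebraMap (chartRing c j) (Localization.AtPrime 𝔴₂) :
          chartRing c j →+* Localization.AtPrime 𝔴₂)
          (MvPolynomial.eval₂Hom (chartBase c j) (fun i => chartGen c j i) F) ∈
        maximalIdeal (Localization.AtPrime 𝔴₂) ^ μ)
    (hτ : hironakaTauAt c J μ = 2) : 𝔴₁ = 𝔴₂ := by
  classical
  -- one reduction map `ρ` serves both primes
  have hcq : IsQuasiRegular c := isQuasiRegular_rsop_comp hd c hc id Function.injective_id
  have hcm : ∀ l, c l ∈ maximalIdeal R := fun l => hc ▸ Ideal.subset_span ⟨l, rfl⟩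
  obtain ⟨ρ, hρsurj, hρker, hρF⟩ :
      ∃ ρ : chartRing c j →+* MvPolynomial {i : Fin 3 // i ≠ j} (ResidueField R),
        Function.Surjective ρ ∧ RingHom.ker ρ = (maximalIdeal R).map (chartBase c j) ∧
        ∀ F : MvPolynomial (Fin 3) R,
          ρ (MvPolynomial.eval₂Hom (chartBase c j) (fun i => chartGen c j i) F) =
            MvPolynomial.map (residue R) (dehomogenize j F) :=
    exists_chartResidueMap c j hcq hcm
  have aux : ∀ (𝔴 : Ideal (chartRing c j)) [𝔴.IsPrime], (maximalIdeal R).map (chartBase c j) ≤ 𝔴 →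
      (∀ F : MvPolynomial (Fin 3) R, F.IsHomogeneous μ → MvPolynomial.eval c F ∈ J →
        (algebraMap (chartRing c j) (Localization.AtPrime 𝔴) :
            chartRing c j →+* Localization.AtPrime 𝔴)
            (MvPolynomial.eval₂Hom (chartBase c j) (fun i => chartGen c j i) F) ∈
          maximalIdeal (Localization.AtPrime 𝔴) ^ μ) →
      (𝔴.map ρ).IsPrime ∧ 𝔴 = (𝔴.map ρ).comap ρ ∧
      ∀ G ∈ (initialForms c J μ : Set (MvPolynomial (Fin 3) (ResidueField R))),
        G.IsHomogeneous μ ∧ ∃ s ∉ 𝔴.map ρ, s * dehomogenize j G ∈ 𝔴.map ρ ^ μ := by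
    intro 𝔴 _ h𝔴 hnear
    have hker : RingHom.ker ρ ≤ 𝔴 := hρker.trans_le h𝔴
    haveI h𝔮 : (𝔴.map ρ).IsPrime := Ideal.map_isPrime_of_surjective hρsurj hker
    have hcomap : 𝔴 = (𝔴.map ρ).comap ρ := by
      rw [Ideal.comap_map_of_surjective ρ hρsurj, ← RingHom.ker_eq_comap_bot, sup_eq_left.mpr hker]
    refine ⟨h𝔮, hcomap, fun G hG => ?_⟩
    obtain ⟨F, hF, hFJ, rfl⟩ := (mem_initialForms_iff c).mp hG
    refine ⟨hF.map _, ?_⟩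
    have hnear' : algebraMap _ (Localization.AtPrime (𝔴.map ρ))
        (MvPolynomial.map (residue R) (dehomogenize j F)) ∈
        maximalIdeal (Localization.AtPrime (𝔴.map ρ)) ^ μ := by
      rw [← hρF F, ← Localization.localRingHom_to_map 𝔴 (𝔴.map ρ) ρ hcomap]
      exact Ideal.map_maximalIdeal_pow_le (Localization.localRingHom 𝔴 (𝔴.map ρ) ρ hcomap) μ
        (Ideal.mem_map_of_mem _ (hnear F hF hFJ))
    obtain ⟨s, hs, hsg⟩ := exists_mul_mem_pow_of_algebraMap_mem_maximalIdeal_pow (𝔴.map ρ)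
      (Localization.AtPrime (𝔴.map ρ)) hnear'
    refine ⟨s, hs, ?_⟩
    rwa [map_dehomogenize] at hsg
  obtain ⟨h1, hc1, hS1⟩ := aux 𝔴₁ h𝔴₁ hnear₁
  obtain ⟨h2, hc2, hS2⟩ := aux 𝔴₂ h𝔴₂ hnear₂
  haveI := h1
  haveI := h2
  have heq := eq_of_near_of_near_of_hironakaTau_eq_two j (𝔴₁.map ρ) (𝔴₂.map ρ) hS1 hS2 hτ
  rw [hc1, hc2, heq]

end Ring

/-! ## Scheme level: the blowing up of a closed point of a regular threefold -/

section Scheme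

variable {X X' : Scheme.{u}} {π : X' ⟶ X}

set_option maxHeartbeats 400000 in
/-- **[CoP1] Lemma 4.3 (1): a near point over a point centre forces `τ(x) ≤ 2`.** Let `π` be the
blowing up of the locally Noetherian `X` along a centre `Y`, let `x′ ∈ X′` lie over `x = π x′`
with `𝒪_{X,x}` regular of dimension `3`, and suppose `𝓘_{Y,x} = 𝔪_x = (c_1, c_2, c_3)` for a
regular system of parameters `c` (`Y = {x}` near the closed point `x` of the threefold, in [CoP1]).
If `x′` is near (`ord_{x′} J′ = μ`, `J′` the weak transform), then `τ(x) ≤ 2` (no permissibility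
hypothesis is needed for this direction).
[cite: CossartPiltant2008, Lemma 4.3 (1); Hironaka1970, Thm. 2] -/
theorem IsBlowup.stalkTau_le_two_of_isNear_point [IsLocallyNoetherian X] [IsLocallyNoetherian X']
    {Y : Closeds X} (hπ : IsBlowup π (vanishingIdeal Y)) {J : X.IdealSheafData} {μ : ℕ} {x' : X'}
    [IsRegularLocalRing (X.presheaf.stalk (π x'))]
    (hd : (maximalIdeal (X.presheaf.stalk (π x'))).spanFinrank = 3)
    {c : Fin 3 → X.presheaf.stalk (π x')} (hc : Ideal.span (Set.range c) = maximalIdeal _)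
    (hcY : Ideal.span (Set.range c) = stalkIdeal (vanishingIdeal Y) (π x'))
    (hnear : IsNear π (vanishingIdeal Y) J μ x') :
    stalkTau J (π x') μ ≤ 2 := by
  classical
  rw [stalkTau_eq J (π x') μ hd c hc]
  -- the chart presentation `𝒪_{X',x'} = (B_j)_𝔴`, `𝔴 ⊇ 𝔪 B_j`
  obtain ⟨j, 𝔴, χ, hχ, hloc, h𝔴⟩ := hπ.exists_reesChart_stalk x' c hcY
  have h𝔴' : (maximalIdeal _).map (chartBase c j) ≤ 𝔴.asIdeal := by
    rw [← h𝔴]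
    exact Ideal.map_comap_le
  refine hironakaTauAt_le_two_of_near_point hd c hc j 𝔴.asIdeal h𝔴' ?_
  intro F hF hFJ
  exact algebraMap_eval₂Hom_mem_pow_of_isNear hcY j 𝔴 χ hχ hloc hnear hF hFJ

/-- **[CoP1] Lemma 4.3 (1), as printed: "If `τ(x) = 3`, then … no `x′ ∈ q⁻¹(x)` is near `x`."**
[cite: CossartPiltant2008, Lemma 4.3 (1); Hironaka1970, Thm. 2] -/
theorem IsBlowup.not_isNear_of_stalkTau_eq_three [IsLocallyNoetherian X] [IsLocallyNoetherian X']
    {Y : Closeds X} (hπ : IsBlowup π (vanishingIdeal Y)) {J : X.IdealSheafData} {μ : ℕ} {x' : X'}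
    [IsRegularLocalRing (X.presheaf.stalk (π x'))]
    (hd : (maximalIdeal (X.presheaf.stalk (π x'))).spanFinrank = 3)
    {c : Fin 3 → X.presheaf.stalk (π x')} (hc : Ideal.span (Set.range c) = maximalIdeal _)
    (hcY : Ideal.span (Set.range c) = stalkIdeal (vanishingIdeal Y) (π x'))
    (hτ : stalkTau J (π x') μ = 3) :
    ¬ IsNear π (vanishingIdeal Y) J μ x' := fun hnear =>
  absurd (hπ.stalkTau_le_two_of_isNear_point hd hc hcY hnear) (by omega)

/-- Equivalently: over a point centre with `τ(x) = 3`, **the order of the weak transform drops at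
every point: `ord_{x′} J′ < μ`.** [cite: CossartPiltant2008, Lemma 4.3 (1)] -/
theorem IsBlowup.idealOrder_controlledTransform_lt_of_stalkTau_eq_three [IsLocallyNoetherian X]
    [IsLocallyNoetherian X'] (hX : Scheme.IsRegular X) {Y : Closeds X}
    (hreg : Scheme.IsRegular (vanishingIdeal Y).subscheme) (hπ : IsBlowup π (vanishingIdeal Y))
    {J : X.IdealSheafData} {μ : ℕ} (hY : ∀ y ∈ (Y : Set X), idealOrder J y = μ)
    {x' : X'} [IsRegularLocalRing (X.presheaf.stalk (π x'))]
    (hd : (maximalIdeal (X.presheaf.stalk (π x'))).spanFinrank = 3)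
    {c : Fin 3 → X.presheaf.stalk (π x')} (hc : Ideal.span (Set.range c) = maximalIdeal _)
    (hcY : Ideal.span (Set.range c) = stalkIdeal (vanishingIdeal Y) (π x'))
    (hτ : stalkTau J (π x') μ = 3) :
    idealOrder (controlledTransform π (vanishingIdeal Y) J μ) x' < μ := by
  have hx : π x' ∈ (Y : Set X) := by
    rw [← coe_support_vanishingIdeal, SetLike.mem_coe, mem_support_iff_stalkIdeal_le, ← hcY, hc]
  have hle := hπ.idealOrder_controlledTransform_le_of_mem hX hreg hY hx
  refine lt_of_le_of_ne hle fun heq => ?_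
  exact hπ.not_isNear_of_stalkTau_eq_three hd hc hcY hτ (isNear_iff.mpr heq)

set_option maxHeartbeats 400000 in
/-- **[CoP1] Lemma 4.3 (3): at `τ(x) = 2` a near point over a point centre is rational over `x`.**
In the situation of `IsBlowup.stalkTau_le_two_of_isNear_point` with `τ(x) = 2`: if `x′` is near
then `k(x) → k(x′)` is onto. [cite: CossartPiltant2008, Lemma 4.3 (3)] -/
theorem IsBlowup.residue_comp_stalkMap_surjective_of_isNear_point [IsLocallyNoetherian X]
    [IsLocallyNoetherian X'] {Y : Closeds X} (hπ : IsBlowup π (vanishingIdeal Y))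
    {J : X.IdealSheafData} {μ : ℕ} {x' : X'} [IsRegularLocalRing (X.presheaf.stalk (π x'))]
    (hd : (maximalIdeal (X.presheaf.stalk (π x'))).spanFinrank = 3)
    {c : Fin 3 → X.presheaf.stalk (π x')} (hc : Ideal.span (Set.range c) = maximalIdeal _)
    (hcY : Ideal.span (Set.range c) = stalkIdeal (vanishingIdeal Y) (π x'))
    (hτ : stalkTau J (π x') μ = 2) (hnear : IsNear π (vanishingIdeal Y) J μ x') :
    Function.Surjective
      ((IsLocalRing.residue (X'.presheaf.stalk x')).comp (π.stalkMap x').hom) := by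
  classical
  rw [stalkTau_eq J (π x') μ hd c hc] at hτ
  -- the chart presentation `𝒪_{X',x'} = (B_j)_𝔴`, `𝔴 ⊇ 𝔪 B_j`
  obtain ⟨j, 𝔴, χ, hχ, hloc, h𝔴⟩ := hπ.exists_reesChart_stalk x' c hcY
  have h𝔴' : (maximalIdeal _).map (chartBase c j) ≤ 𝔴.asIdeal := by
    rw [← h𝔴]
    exact Ideal.map_comap_le
  have hnearF : ∀ F : MvPolynomial (Fin 3) (X.presheaf.stalk (π x')), F.IsHomogeneous μ →
      MvPolynomial.eval c F ∈ stalkIdeal J (π x') →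
      (algebraMap (chartRing c j) (Localization.AtPrime 𝔴.asIdeal) :
          chartRing c j →+* Localization.AtPrime 𝔴.asIdeal)
          (MvPolynomial.eval₂Hom (chartBase c j) (fun i => chartGen c j i) F) ∈
        maximalIdeal (Localization.AtPrime 𝔴.asIdeal) ^ μ :=
    fun F hF hFJ => algebraMap_eval₂Hom_mem_pow_of_isNear hcY j 𝔴 χ hχ hloc hnear hF hFJ
  -- `R → B_j/𝔴` is onto, `𝔴` is maximal, hence `R → k(x')` is onto
  have hsurj := quotient_mk_comp_chartBase_surjective_of_near_point hd c hc j 𝔴.asIdeal h𝔴'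
    hnearF hτ
  haveI h𝔴max : 𝔴.asIdeal.IsMaximal := isMaximal_of_near_point hd c hc j 𝔴.asIdeal h𝔴' hnearF hτ
  letI := χ.toAlgebra
  haveI : IsLocalization.AtPrime (X'.presheaf.stalk x') 𝔴.asIdeal := hloc
  have key := surjective_residue_comp_of_surjective_quotient_comp (S := X'.presheaf.stalk x')
    (chartBase c j) 𝔴.asIdeal hsurj
  have heq : (IsLocalRing.residue (X'.presheaf.stalk x')).comp (π.stalkMap x').hom =
      (IsLocalRing.residue (X'.presheaf.stalk x')).comp
        ((algebraMap (chartRing c j) (X'.presheaf.stalk x')).comp (chartBase c j)) := by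
    ext a
    rw [RingHom.comp_apply, RingHom.comp_apply, RingHom.comp_apply, ← hχ]
    rfl
  rw [heq]
  exact key

end Scheme

end Literature.AlgebraicGeometry.Resolution

end
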